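import Summits.ResolutionOfSingularities.ResolutionOfSingularities.Theorems.FrobeniusLadderFInjectiveMacaulayficationLaurentDescent
import Mathlib.RingTheory.KrullDimension.Polynomial
import Mathlib.RingTheory.Localization.AtPrime.Basic
import HarnessLib

/-!
# Dimension of `A[X]` at `𝔫·A[X] + (X − 1)` (crux `FInjectiveMacaulayfication`, line `graded-engine`, §16 helper D3)

Support file for crux stmt-ResolutionOfSingularities-15315 (`FrobeniusLadder.FInjectiveMacaulayfication`), §16 THE GRADED
ENGINE (CRUX-PLAN w45a v3, line `graded-engine`, registered stub G4 `stub_gradedChartClause`; design memo GRADED-ENGINE.md v2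
step (v), lead seat res-L1-w45a-lead-1, typed helper target D3 `dim_polynomial_at_one` of `GradedChartClausePlan.lean`).
[OURS · L1 W4.5a] — an elementary dimension count, not a statement of any manuscript.

The Laurent descent `LaurentDescent.laurentDescent` (p470480) brings the Cohen–Macaulay + Frobenius-closed clause down
from `A[X]_𝔑` to `A_𝔫`, where `𝔫` is a maximal ideal of `A` and `𝔑 = 𝔫·A[X] + (X − 1)`, under the hypothesis
`dim A[X]_𝔑 = dim A_𝔫 + 1`. This file discharges that hypothesis for every Noetherian `A`:

* `isMaximal_of_eq` — `𝔑` is maximal (it is the preimage of `𝔫` under evaluation at `1`);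
* `liesOver_of_eq` — `𝔑 ∩ A = 𝔫`;
* `height_eq_height_add_one` — `ht 𝔑 = ht 𝔫 + 1` (Mathlib `Polynomial.height_eq_height_add_one`: a maximal ideal of
  `A[X]` over the prime `𝔫` of a Noetherian ring has height `ht 𝔫 + 1`);
* `ringKrullDim_atPrime_eq_add_one` — hence `dim A[X]_𝔑 = dim A_𝔫 + 1`, in the exact shape of the `hdim` hypothesis of
  `laurentDescent`;
* `dim_polynomial_at_one` — the typed helper target D3 verbatim (all maximal localisations of `A` of dimension `m` ⇒
  `dim A[X]_𝔑 = m + 1`).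

## References

* H. Matsumura, *Commutative Ring Theory*, CUP 1986, Thm. 15.1 / §14 (dimension of fibres of `A → A[X]`:
  `ht P = ht (P ∩ A) + 1` for `P ⊋ (P ∩ A)A[X]`). [Matsumura1987]; folklore.
-/

set_option linter.dupNamespace false

noncomputable section

open Polynomial

namespace Summit.ResolutionOfSingularities.ResolutionOfSingularities.Theorems.FInjectiveMacaulayfication.PolynomialAtOneDim

variable {A : Type} [CommRing A]

/-- `𝔫·A[X] + (X − 1)` is a maximal ideal of `A[X]` when `𝔫` is a maximal ideal of `A`: it is the preimage of `𝔫` under the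
(surjective) evaluation at `X = 1`. [folklore] -/
theorem isMaximal_of_eq (𝔫 : Ideal A) [𝔫.IsMaximal] (𝔑 : Ideal A[X])
    (h𝔑 : 𝔑 = 𝔫.map (Polynomial.C : A →+* A[X]) ⊔ Ideal.span {(X - 1 : A[X])}) : 𝔑.IsMaximal := by
  rw [h𝔑, ← LaurentDescent.comap_evalRingHom_one]
  exact Ideal.comap_isMaximal_of_surjective _ fun a => ⟨C a, by simp⟩

/-- `𝔫·A[X] + (X − 1)` lies over `𝔫`. [folklore] -/
theorem liesOver_of_eq (𝔫 : Ideal A) (𝔑 : Ideal A[X])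
    (h𝔑 : 𝔑 = 𝔫.map (Polynomial.C : A →+* A[X]) ⊔ Ideal.span {(X - 1 : A[X])}) : 𝔑.LiesOver 𝔫 :=
  ⟨by rw [Ideal.under_def, Polynomial.algebraMap_eq]; exact LaurentDescent.comap_C_eq 𝔫 𝔑 h𝔑⟩

/-- **`ht (𝔫·A[X] + (X − 1)) = ht 𝔫 + 1`** for a maximal ideal `𝔫` of a Noetherian ring `A`
(Mathlib `Polynomial.height_eq_height_add_one`). [folklore; Matsumura Thm. 15.1] -/
theorem height_eq_height_add_one [IsNoetherianRing A] (𝔫 : Ideal A) [𝔫.IsMaximal] (𝔑 : Ideal A[X])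
    (h𝔑 : 𝔑 = 𝔫.map (Polynomial.C : A →+* A[X]) ⊔ Ideal.span {(X - 1 : A[X])}) :
    𝔑.height = 𝔫.height + 1 := by
  haveI := isMaximal_of_eq 𝔫 𝔑 h𝔑
  haveI := liesOver_of_eq 𝔫 𝔑 h𝔑
  exact Polynomial.height_eq_height_add_one 𝔫 𝔑

/-- **`dim A[X]_𝔑 = dim A_𝔫 + 1`** for `𝔑 = 𝔫·A[X] + (X − 1)`, `𝔫` maximal in a Noetherian ring `A` — the `hdim` hypothesis of
`LaurentDescent.laurentDescent` (p470480), in its exact shape. [folklore; Matsumura Thm. 15.1] -/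
theorem ringKrullDim_atPrime_eq_add_one [IsNoetherianRing A] (𝔫 : Ideal A) [𝔫.IsMaximal] (𝔑 : Ideal A[X]) [𝔑.IsPrime]
    (h𝔑 : 𝔑 = 𝔫.map (Polynomial.C : A →+* A[X]) ⊔ Ideal.span {(X - 1 : A[X])}) :
    ∀ d : ℕ, ringKrullDim (Localization.AtPrime 𝔫) = d →
      ringKrullDim (Localization.AtPrime 𝔑) = ((d + 1 : ℕ) : WithBot ℕ∞) := by
  intro d hd
  rw [IsLocalization.AtPrime.ringKrullDim_eq_height 𝔫 (Localization.AtPrime 𝔫)] at hd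
  have hd' : 𝔫.height = d := by exact_mod_cast hd
  rw [IsLocalization.AtPrime.ringKrullDim_eq_height 𝔑 (Localization.AtPrime 𝔑),
    height_eq_height_add_one 𝔫 𝔑 h𝔑, hd']
  norm_cast

/-- **D3 `dim_polynomial_at_one`** (typed helper target of the G4 assembly plan, verbatim): for a Noetherian ring `A` all of
whose maximal localisations have dimension `m`, a maximal ideal `𝔫` and `𝔑 = 𝔫·A[Y] + (Y − 1)`, the local ring `A[Y]_𝔑` has
dimension `m + 1`. (Only the dimension of `A_𝔫` itself is used: `ringKrullDim_atPrime_eq_add_one`.) [folklore; Matsumura Thm. 15.1] -/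
theorem dim_polynomial_at_one (A : Type) [CommRing A] [IsNoetherianRing A] (m : ℕ)
    (hA : ∀ (𝔫 : Ideal A) [𝔫.IsMaximal], ringKrullDim (Localization.AtPrime 𝔫) = m)
    (𝔫 : Ideal A) [𝔫.IsMaximal] (𝔑 : Ideal (Polynomial A)) [𝔑.IsPrime]
    (h𝔑 : 𝔑 = 𝔫.map (Polynomial.C : A →+* A[X]) ⊔ Ideal.span {(Polynomial.X - 1 : A[X])}) :
    ringKrullDim (Localization.AtPrime 𝔑) = ((m + 1 : ℕ) : WithBot ℕ∞) :=
  ringKrullDim_atPrime_eq_add_one 𝔫 𝔑 h𝔑 m (hA 𝔫)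

end Summit.ResolutionOfSingularities.ResolutionOfSingularities.Theorems.FInjectiveMacaulayfication.PolynomialAtOneDim

end
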